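import Literature.RingTheory.FittingIdeal.Basic
import Mathlib.LinearAlgebra.TensorProduct.Tower
import Mathlib.RingTheory.TensorProduct.Basic
import Mathlib.RingTheory.Ideal.Maps
import HarnessLib

/-!
# Fitting ideals: functoriality in the module and in the ring (Stacks, Tag 07ZA)

Topic: `Literature/RingTheory/FittingIdeal`. Two of the basic properties of the Fitting ideals
`Fitt_k(M)` (`Literature.RingTheory.FittingIdeal.Module.fittingIdeal`, `Basic.lean`; Eisenbud,
*Commutative Algebra*, §20.2) listed in The Stacks Project, Tag 07ZA: "(3) If `M → M'` is
surjective, then `Fitt_k(M) ⊆ Fitt_k(M')`. (4) If `R → R'` is a ring map, then `Fitt_k(M ⊗_R R')`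
is the ideal of `R'` generated by the image of `Fitt_k(M)`" (Eisenbud, Cor. 20.5: "the
formation of Fitting ideals commutes with base change"). With the intrinsic definition both are
immediate in the stated direction: a generating family and its relations push forward along a
surjection, resp. along `m ↦ 1 ⊗ m`, and determinants are preserved by ring maps. All proved:

* `Module.fittingIdeal_le_of_surjective` — (3); `Module.fittingIdeal_eq_of_linearEquiv` —
  invariance under isomorphism;
* `Module.map_fittingIdeal_le_baseChange` — the inclusion `Fitt_k(M) R' ⊆ Fitt_k(R' ⊗_R M)` of
  (4) (the reverse inclusion needs Fitting's lemma, Stacks 07Z8, and is not proved here).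

## Sources

* The Stacks Project, Tag 07ZA (3), (4); Tag 07Z8.
* D. Eisenbud, *Commutative Algebra with a View Toward Algebraic Geometry*, GTM 150 (1995),
  §20.2, Cor. 20.5.
-/

namespace Literature.RingTheory.FittingIdeal

open TensorProduct

universe u v w

variable {R : Type u} [CommRing R] {M : Type v} [AddCommGroup M] [Module R M]
  {N : Type w} [AddCommGroup N] [Module R N]

/-- **Stacks 07ZA (3): Fitting ideals grow along surjections** — if `f : M → N` is a surjective
`R`-linear map then `Fitt_k(M) ⊆ Fitt_k(N)`: a generating family of `M` maps to a generating
family of `N` and its relations remain relations. [cite: Eisenbud1995, §20.2] -/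
theorem Module.fittingIdeal_le_of_surjective (f : M →ₗ[R] N) (hf : Function.Surjective f)
    (k : ℕ) : Module.fittingIdeal R M k ≤ Module.fittingIdeal R N k := by
  refine Ideal.span_le.mpr ?_
  rintro _ ⟨j, x, ρ, σ, hx, hρ, rfl⟩
  refine Module.det_mem_fittingIdeal (fun l => f (x l)) ?_ ρ (fun i => ?_) σ
  · have h1 : Set.range (fun l => f (x l)) = f '' Set.range x := by
      ext m
      simp [Set.mem_image, Set.mem_range]
    rw [h1, Submodule.span_image, hx, Submodule.map_top, LinearMap.range_eq_top.mpr hf]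
  · have := congrArg f (hρ i)
    simpa only [map_sum, map_smul, map_zero] using this

/-- Fitting ideals are invariant under isomorphisms of modules. [cite: Eisenbud1995, §20.2] -/
theorem Module.fittingIdeal_eq_of_linearEquiv (e : M ≃ₗ[R] N) (k : ℕ) :
    Module.fittingIdeal R M k = Module.fittingIdeal R N k :=
  le_antisymm (Module.fittingIdeal_le_of_surjective e.toLinearMap e.surjective k)
    (Module.fittingIdeal_le_of_surjective e.symm.toLinearMap e.symm.surjective k)

/-- **Stacks 07ZA (4), Eisenbud Cor. 20.5 (one inclusion): Fitting ideals and base change** —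
for an `R`-algebra `S`, the extension of `Fitt_k(M)` to `S` is contained in
`Fitt_k(S ⊗_R M)`: the family `1 ⊗ xₗ` generates `S ⊗_R M`, the relations extend, and
`algebraMap (det A) = det (algebraMap ∘ A)`. (Equality holds; the reverse inclusion needs
Fitting's lemma.) [cite: Eisenbud1995, Cor. 20.5] -/
theorem Module.map_fittingIdeal_le_baseChange (S : Type u) [CommRing S] [Algebra R S] (k : ℕ) :
    (Module.fittingIdeal R M k).map (algebraMap R S) ≤
      Module.fittingIdeal S (S ⊗[R] M) k := by
  refine Ideal.map_le_of_le_comap (Ideal.span_le.mpr ?_)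
  rintro _ ⟨j, x, ρ, σ, hx, hρ, rfl⟩
  rw [SetLike.mem_coe, Ideal.mem_comap, RingHom.map_det]
  refine Module.det_mem_fittingIdeal (R := S) (M := S ⊗[R] M) (fun l => (1 : S) ⊗ₜ[R] x l) ?_
    (fun i l => algebraMap R S (ρ i l)) (fun i => ?_) σ
  · -- `1 ⊗ xₗ` generate `S ⊗ M`
    have h1 : Set.range (fun l => (1 : S) ⊗ₜ[R] x l) =
        (TensorProduct.mk R S M 1) '' Set.range x := by
      ext m
      simp [Set.mem_image, Set.mem_range]
    rw [h1, ← Submodule.span_span_of_tower R, Submodule.span_image, hx, Submodule.map_top]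
    rw [eq_top_iff]
    rintro t -
    induction t using TensorProduct.induction_on with
    | zero => exact Submodule.zero_mem _
    | tmul s m =>
      have hm : (1 : S) ⊗ₜ[R] m ∈ Submodule.span S
          (LinearMap.range (TensorProduct.mk R S M 1) : Set (S ⊗[R] M)) :=
        Submodule.subset_span ⟨m, rfl⟩
      have := Submodule.smul_mem _ s hm
      rwa [TensorProduct.smul_tmul', smul_eq_mul, mul_one] at this
    | add a b ha hb => exact Submodule.add_mem _ ha hb
  · have := congrArg (TensorProduct.mk R S M 1) (hρ i)
    rw [map_sum, map_zero] at this
    rw [← this]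
    refine Finset.sum_congr rfl fun l _ => ?_
    rw [map_smul, TensorProduct.mk_apply, algebraMap_smul]

/-! ## Transport along isomorphisms of pairs (ring, module)

(Moved here from `Literature/AlgebraicGeometry/Resolution/AlterationsSemiStableNodeStructure.lean`,
its original home, so that light files can use it.) -/

section Transport

variable {R R' : Type*} [CommRing R] [CommRing R'] {M M' : Type*} [AddCommGroup M] [Module R M]
  [AddCommGroup M'] [Module R' M']

/-- A generating family stays generating after transport along a ring isomorphism `ε` and a
compatible additive isomorphism `e` of modules. [folklore] -/
theorem span_range_comp_eq_top_of_addEquiv (ε : R ≃+* R') (e : M ≃+ M')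
    (he : ∀ (r : R) (m : M), e (r • m) = ε r • e m) {ι : Type*} {x : ι → M}
    (hx : Submodule.span R (Set.range x) = ⊤) :
    Submodule.span R' (Set.range (e ∘ x)) = ⊤ := by
  rw [eq_top_iff]
  rintro m' -
  obtain ⟨m, rfl⟩ := e.surjective m'
  have hm : m ∈ Submodule.span R (Set.range x) := by
    rw [hx]
    trivial
  induction hm using Submodule.span_induction with
  | mem y hy =>
    obtain ⟨i, rfl⟩ := hy
    exact Submodule.subset_span ⟨i, rfl⟩
  | zero =>
    rw [map_zero]
    exact zero_mem _
  | add y z _ _ hy hz =>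
    rw [map_add]
    exact add_mem hy hz
  | smul r y _ hy =>
    rw [he]
    exact Submodule.smul_mem _ _ hy

/-- One inclusion of `fittingIdeal_map_ringEquiv`: the image of a defining minor of
`Fitt_k(M)` is a defining minor of `Fitt_k(M')` (transport the generators, the relations and the
determinant). [cite: Eisenbud1995, §20.2] -/
theorem fittingIdeal_map_le_of_addEquiv (ε : R ≃+* R') (e : M ≃+ M')
    (he : ∀ (r : R) (m : M), e (r • m) = ε r • e m) (k : ℕ) :
    (Module.fittingIdeal R M k).map (ε : R →+* R') ≤ Module.fittingIdeal R' M' k := by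
  rw [Module.fittingIdeal, Ideal.map_span]
  refine Ideal.span_mono ?_
  rintro _ ⟨d, ⟨j, x, ρ, σ, hx, hρ, rfl⟩, rfl⟩
  refine ⟨j, e ∘ x, fun i l => ε (ρ i l), σ, span_range_comp_eq_top_of_addEquiv ε e he hx,
    fun i => ?_, ?_⟩
  · have h := congrArg e (hρ i)
    rw [map_zero, map_sum] at h
    simpa only [Function.comp_apply, he] using h
  · show (ε : R →+* R') (Matrix.det _) = _
    rw [RingHom.map_det]
    congr 1

/-- **Fitting ideals are invariants of the module** (Eisenbud §20.2; the intrinsic definition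
of `Module.fittingIdeal` makes this a transport of structure): along a ring isomorphism
`ε : R ≅ R'` and an additive isomorphism `e : M ≅ M'` with `e(r • m) = ε(r) • e(m)`,
`ε(Fitt_k(M)) = Fitt_k(M')`. [cite: Eisenbud1995, §20.2] -/
theorem fittingIdeal_map_ringEquiv (ε : R ≃+* R') (e : M ≃+ M')
    (he : ∀ (r : R) (m : M), e (r • m) = ε r • e m) (k : ℕ) :
    (Module.fittingIdeal R M k).map (ε : R →+* R') = Module.fittingIdeal R' M' k := by
  refine le_antisymm (fittingIdeal_map_le_of_addEquiv ε e he k) ?_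
  have he' : ∀ (r : R') (m : M'), e.symm (r • m) = ε.symm r • e.symm m := by
    intro r m
    apply e.injective
    rw [e.apply_symm_apply, he, ε.apply_symm_apply, e.apply_symm_apply]
  have h := Ideal.map_mono (f := (ε : R →+* R')) (fittingIdeal_map_le_of_addEquiv ε.symm e.symm he' k)
  have h' : ((Module.fittingIdeal R' M' k).map (ε.symm : R' →+* R)).map
      (ε.symm.symm : R →+* R') = Module.fittingIdeal R' M' k := Ideal.map_of_equiv _
  rw [RingEquiv.symm_symm] at h'
  rwa [h'] at h

end Transport

end Literature.RingTheory.FittingIdeal
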